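import Mathlib
import HarnessLib
import Summits.HubbardSuperconductivity.HubbardSuperconductivity.Theorems.KLProgrammeKLRegimeTwoVolumeTowerStepCovData

/-!
# K3 VL child `KLRegimeVolumeLimitV17F2` (stmt-HubbardSuperconductivity-20440), blueprint v5 M3b-j AT THE FIRST STEP `k = 0`: the scale-`0` fat multipliers are the
# RADIAL PLATEAU, so `klStepCov V M β μ K 0` is the PLAIN slice `C^K_{(Λ₂,Λ₁]}` in two identical sector copies (located item «SCALE-0-STEPCOV», p3 g12)

Cell `gate-hubbard-kl`, seat p3 (g12).  The W5 tower spine runs its covariance steps `klTowerState (k+1) = effAction (klStepCovD … k) (klTowerD … k)` for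
`k = 0 … n⋆−2`; p3's anisotropic doors (`scaleCovData_/scaleCovSecData_klStepCov_klEng_flow_deep_vol`) need `1 ≤ k` (tangent resolution `N_r = 2^k ≥ 2`).
This file records WHY the step `k = 0` is different and reduces it to ONE isotropic, model-free estimate:

* `bgmFatMultiplier_zero_eq_one` — `sectorCount 0 = 2` and the neighbour filter `ω′ ≡ ω, ω ± 1 (mod 2)` is ALL of `range 2`, so the angular factor is the full
  partition of unity `Σ_ω ζ̃_{0,ω} = 1` (`sum_sectorWeightCirc_eq_one`), and the radial factor `C_1⁻¹(r) = 1` for `r ≤ e₀` (`gnScaleCutoff_eq_one`): the scale-`0`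
  fat multiplier is `≡ 1` on `√(k₀² + e(k⃗)²) ≤ e₀`, for BOTH `ω`;
* `bgmFatMultiplier_zero_mul_sliceSymbolFnXi` — the slice weight of `(Λ, Λ′]` vanishes off `k₀² + ξ² ≤ Λ′²` (`sliceWeightFn_eq_zero_of_not_mem`), so for
  `Λ′ ≤ e₀` the per-pair symbol `F̃_{0,ω}F̃_{0,ω′}Ψ̂_{(Λ,Λ′]} = Ψ̂_{(Λ,Λ′]}` IDENTICALLY (every pair `(ω, ω′)`);
* **`secRowWt_klStepCov_zero_le`** / **`rowSumWt_klStepCov_zero_le`** — hence every sectional (fixed time + label) weighted row of `klStepCov V M β μ K 0` is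
  `≤ 2·T` and every all-labels weighted row `≤ 8·(2·T)` as soon as the `w`-weighted `ℓ¹` norm of the PLAIN slice character sum
  `z ↦ Σ_q χ_q(z) • ((βV²)⁻²·Ψ̂_{(Λ₂,Λ₁]}(ω(q₁), e_K(q₂)))` is `≤ T` (fixed-time form / all-times form; `w` even, nonnegative; generic dictionaries
  `secRowWt_norm_pullback_sliceCT_le`, `rowSumWt_norm_pullback_sliceCT_le`).
WHAT IS LEFT for «SCALE-0-STEPCOV» (not here): the isotropic weighted `ℓ¹` bounds `T` of that plain kernel at the FIXED scales `Λ₂ = klE0/16`, `Λ₁ = klE0/4`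
(inputs in the tree: `…SliceSymbolTorus` sup / first / second differences in time and space, `HubbardSliceSymbolSmoothXiThird` for the moment; one isotropic
instance of `sum_wt_norm_charSum_le_of_third_differences`), and the Gram constant (`gram_entry_klSliceCov_bgmFat_klEng` also wants `1 ≤ n`).

Everything is proved; no definitions. [cite: BenfattoGiulianiMastropietro2006, §2.3 (2.19), §2.5 (2.45), §2.7 (2.66)–(2.67)]
-/

noncomputable section

namespace Summit.HubbardSuperconductivity.HubbardSuperconductivity.Theorems.TorusFourierL2

set_option linter.dupNamespace false -- summit = problem name (single-conjunct summit), D-0017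

open Set Finset Literature.MathematicalPhysics.QuantumLattice Literature.MathematicalPhysics.QuantumLattice.BandSectorCounting
open Literature.MathematicalPhysics.QuantumLattice.FermiRG Literature.Probability.LatticeModels Literature.Analysis.SpecialFunctions
open Summit.HubbardSuperconductivity.HubbardSuperconductivity.Theorems.DispersionFlow
open Summit.HubbardSuperconductivity.HubbardSuperconductivity.Theorems.KLRegimeSplit
open Summit.HubbardSuperconductivity.HubbardSuperconductivity.Theorems.KLProgrammeLegKernels
open Summit.HubbardSuperconductivity.HubbardSuperconductivity.Theorems.PerturbedFermiCurve
open Summit.HubbardSuperconductivity.HubbardSuperconductivity.Theorems.KLRegimeWick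
open Summit.HubbardSuperconductivity.HubbardSuperconductivity.Theorems.TwoVolumeSource
open scoped Real Nat

open Classical

section Plateau

variable {L M : ℕ} [NeZero L] [NeZero M]

omit [NeZero L] [NeZero M] in
/-- **The scale-`0` fat multiplier is the radial plateau**: for both `ω ∈ Fin 2`, `F̃_{0,ω}(k) = 1` whenever `√(k₀² + e(k⃗)²) ≤ e₀` (the neighbour filter at
`N = 2` is everything, the angular partition of unity sums to `1`, and `C_1⁻¹ ≡ 1` below `e₀`). [cite: BenfattoGiulianiMastropietro2006, §2.3 (2.19), §2.5 (2.45)] -/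
theorem bgmFatMultiplier_zero_eq_one {e₀ : ℝ} (he : 0 < e₀) (β : ℝ) (e : TorusSite 2 L → ℝ) (ω : Fin (sectorCount 0)) (i : MatsubaraIdx M)
    (q : TorusSite 2 L) (hk : Real.sqrt (matsubaraFreq β M i ^ 2 + e q ^ 2) ≤ e₀) : bgmFatMultiplier L M e₀ β e 0 ω (i, q) = 1 := by
  unfold bgmFatMultiplier
  have h1 : gnScaleCutoff 4 e₀ (-((0 : ℕ) : ℤ) + 1) (Real.sqrt (matsubaraFreq β M i ^ 2 + e q ^ 2)) = 1 :=
    gnScaleCutoff_eq_one (by norm_num) he (by simpa using hk)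
  have h2 : (range (sectorCount 0)).filter
      (fun ω' : ℕ => ∃ δ : ℤ, |δ| ≤ 1 ∧ (sectorCount 0 : ℤ) ∣ ((ω' : ℤ) - ((ω : ℕ) : ℤ) - δ)) = range (sectorCount 0) := by
    refine Finset.filter_true_of_mem fun ω' hω' => ?_
    have hω'2 : ω' < 2 := by simpa [sectorCount] using hω'
    have hω2 : (ω : ℕ) < 2 := by have h := ω.2; simp only [sectorCount] at h; omega
    refine ⟨(ω' : ℤ) - ((ω : ℕ) : ℤ), ?_, by simp⟩
    rw [abs_le]; constructor <;> omega
  rw [h1, h2, sum_sectorWeightCirc_eq_one, one_mul]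
  norm_num

omit [NeZero L] [NeZero M] in
/-- **At scale `0` the per-pair symbol is the plain slice symbol**: for `0 < Λ ≤ Λ′ ≤ e₀` and every pair `(ω, ω′)`,
`F̃_{0,ω}(k)·F̃_{0,ω′}(k)·Ψ̂_{(Λ,Λ′]}(ω(k₀), e_K(k⃗)) = Ψ̂_{(Λ,Λ′]}(ω(k₀), e_K(k⃗))` (on the slice's support both multipliers are `1`, off it both sides vanish).
[cite: BenfattoGiulianiMastropietro2006, §2.7 (2.66)] -/
theorem bgmFatMultiplier_zero_mul_sliceSymbolFnXi {e₀ : ℝ} (he : 0 < e₀) (β μ : ℝ) (K : TrigPolyC4v) {Λ Λ' : ℝ} (hΛ : 0 < Λ) (hΛΛ' : Λ ≤ Λ')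
    (hΛ'e : Λ' ≤ e₀) (c θ : ℝ) (ω ω' : Fin (sectorCount 0)) (i : MatsubaraIdx M) (q : TorusSite 2 L) :
    bgmFatMultiplier L M e₀ β (nambuXiCT L μ K) 0 ω (i, q) * bgmFatMultiplier L M e₀ β (nambuXiCT L μ K) 0 ω' (i, q) *
        sliceSymbolFnXi c θ Λ Λ' (matsubaraFreq β M i) (nambuXiCT L μ K q) =
      sliceSymbolFnXi c θ Λ Λ' (matsubaraFreq β M i) (nambuXiCT L μ K q) := by
  by_cases h : nambuXiCT L μ K q ^ 2 + matsubaraFreq β M i ^ 2 ≤ Λ' ^ 2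
  · have h' : matsubaraFreq β M i ^ 2 + nambuXiCT L μ K q ^ 2 ≤ Λ' ^ 2 := by linarith only [h]
    have hk : Real.sqrt (matsubaraFreq β M i ^ 2 + nambuXiCT L μ K q ^ 2) ≤ e₀ := by
      refine (Real.sqrt_le_sqrt h').trans ?_
      rw [Real.sqrt_sq (hΛ.le.trans hΛΛ')]; exact hΛ'e
    rw [bgmFatMultiplier_zero_eq_one he β _ ω i q hk, bgmFatMultiplier_zero_eq_one he β _ ω' i q hk, one_mul, one_mul]
  · have h0 := (sliceWeightFn_eq_zero_of_not_mem hΛ hΛΛ' (ξ := matsubaraFreq β M i) (ω := nambuXiCT L μ K q) (Or.inr (not_le.mp h))).1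
    simp [sliceSymbolFnXi, h0]

end Plateau

section StepZero

variable {V M : ℕ} [NeZero V] [NeZero M]

/-- **The sectional weighted rows of the first step covariance reduce to the PLAIN slice kernel**: for every nonnegative even spatial weight `w`,
if the `w`-weighted fixed-time `ℓ¹` norm of `z₂ ↦ Σ_q χ_{q₁}(z₁)χ_{q₂}(z₂) • ((βV²)⁻²·Ψ̂_{(Λ₂,Λ₁]}(ω(q₁), e_K(q₂)))` is `≤ T` for every `z₁`, then for every leg `X`,
time slice `t` and label `ℓ`, `Σ_y ‖klStepCov V M β μ K 0 X ((t,y),ℓ)‖·w(x⃗ − y) ≤ 2·T` (`0 < β`). [cite: BenfattoGiulianiMastropietro2006, §2.7 (2.66)–(2.67)] -/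
theorem secRowWt_klStepCov_zero_le {β : ℝ} (hβ : 0 < β) (μ : ℝ) (K : TrigPolyC4v) (w : TorusSite 2 V → ℝ) (hw0 : ∀ z, 0 ≤ w z)
    (hw : ∀ b, w (-b) = w b) {T : ℝ}
    (hT : ∀ z₁ : TorusSite 1 (2 * M), ∑ z₂ : TorusSite 2 V, w z₂ *
        ‖∑ q : TorusSite 1 (2 * M) × TorusSite 2 V, (torusChar q.1 z₁ * torusChar q.2 z₂) •
          ((((1 / (β * (V : ℝ) ^ 2) : ℝ) : ℂ) ^ 2 *
            sliceSymbolFnXi (β * (V : ℝ) ^ 2) 0 (klScale klE0 2) (klScale klE0 1) (matsubaraFreq β M ⟨(q.1 0).val, ZMod.val_lt (q.1 0)⟩)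
              (nambuXiCT V μ K q.2)))‖ ≤ T)
    (X : SpaceTimeIdx V M × SectorLeg (sectorCount 0)) (t : ImagTimeIdx M) (ℓ : SectorLeg (sectorCount 0)) :
    ∑ y : TorusSite 2 V, ‖klStepCov V M β μ K 0 X ((t, y), ℓ)‖ * w (X.1.2 - y) ≤ 2 * T := by
  have he : (0 : ℝ) < klE0 := by norm_num [klE0]
  have hΛ2 : 0 < klScale klE0 2 := klth_klScale_pos 2
  have hΛ21 : klScale klE0 2 ≤ klScale klE0 1 := EngineV8.klScale_le_klScale he.le (by norm_num)
  have hΛ1e : klScale klE0 1 ≤ klE0 := klScale_le_e0 he.le 1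
  rw [klStepCov_eq_klSliceCov, klSliceCov, show (0 + 2 : ℕ) = 2 from rfl, show (2 - 1 : ℕ) = 1 from rfl]
  refine secRowWt_norm_pullback_sliceCT_le hβ.ne' μ K (klScale klE0 2) (klScale klE0 1) _ w hw0 hw X t ℓ fun z₁ => ?_
  refine le_trans (le_of_eq (Finset.sum_congr rfl fun z₂ _ => ?_)) (hT z₁)
  congr 2
  refine Finset.sum_congr rfl fun q _ => ?_
  rw [bgmFatMultiplier_zero_mul_sliceSymbolFnXi he β μ K hΛ2 hΛ21 hΛ1e _ _ X.2.1.1 ℓ.1.1 ⟨(q.1 0).val, ZMod.val_lt (q.1 0)⟩ q.2]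

/-- **The all-labels weighted rows of the first step covariance reduce to the PLAIN slice kernel**: for every nonnegative even weight `w` on the product
torus, if `Σ_z w(z)·‖Σ_q χ_{q₁}(z₁)χ_{q₂}(z₂) • ((βV²)⁻²·Ψ̂_{(Λ₂,Λ₁]})‖ ≤ T`, then `Σ_{Y} ‖klStepCov V M β μ K 0 X Y‖·w(x − y) ≤ 8·(2·T)` (two sector copies `ω′`).
[cite: BenfattoGiulianiMastropietro2006, §2.7 (2.66)–(2.67)] -/
theorem rowSumWt_klStepCov_zero_le {β : ℝ} (hβ : 0 < β) (μ : ℝ) (K : TrigPolyC4v) (w : TorusSite 1 (2 * M) × TorusSite 2 V → ℝ)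
    (hw0 : ∀ z, 0 ≤ w z) (hw : ∀ a b, w (-a, -b) = w (a, b)) {T : ℝ}
    (hT : ∑ z : TorusSite 1 (2 * M) × TorusSite 2 V, w z *
        ‖∑ q : TorusSite 1 (2 * M) × TorusSite 2 V, (torusChar q.1 z.1 * torusChar q.2 z.2) •
          ((((1 / (β * (V : ℝ) ^ 2) : ℝ) : ℂ) ^ 2 *
            sliceSymbolFnXi (β * (V : ℝ) ^ 2) 0 (klScale klE0 2) (klScale klE0 1) (matsubaraFreq β M ⟨(q.1 0).val, ZMod.val_lt (q.1 0)⟩)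
              (nambuXiCT V μ K q.2)))‖ ≤ T)
    (X : SpaceTimeIdx V M × SectorLeg (sectorCount 0)) :
    ∑ Y : SpaceTimeIdx V M × SectorLeg (sectorCount 0),
        ‖klStepCov V M β μ K 0 X Y‖ * w ((fun _ : Fin 1 => ((X.1.1 : ℕ) : ZMod (2 * M)) - ((Y.1.1 : ℕ) : ZMod (2 * M))), X.1.2 - Y.1.2) ≤
      8 * (2 * T) := by
  have he : (0 : ℝ) < klE0 := by norm_num [klE0]
  have hΛ2 : 0 < klScale klE0 2 := klth_klScale_pos 2
  have hΛ21 : klScale klE0 2 ≤ klScale klE0 1 := EngineV8.klScale_le_klScale he.le (by norm_num)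
  have hΛ1e : klScale klE0 1 ≤ klE0 := klScale_le_e0 he.le 1
  rw [klStepCov_eq_klSliceCov, klSliceCov, show (0 + 2 : ℕ) = 2 from rfl, show (2 - 1 : ℕ) = 1 from rfl]
  refine (rowSumWt_norm_pullback_sliceCT_le hβ.ne' μ K (klScale klE0 2) (klScale klE0 1) _ w hw0 hw X).trans ?_
  refine mul_le_mul_of_nonneg_left ?_ (by norm_num)
  calc ∑ ω' : Fin (sectorCount 0), ∑ z : TorusSite 1 (2 * M) × TorusSite 2 V, w z *
        ‖∑ q : TorusSite 1 (2 * M) × TorusSite 2 V, (torusChar q.1 z.1 * torusChar q.2 z.2) •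
          ((((1 / (β * (V : ℝ) ^ 2) : ℝ) : ℂ) ^ 2 *
            (bgmFatMultiplier V M klE0 β (nambuXiCT V μ K) 0 X.2.1.1 (⟨(q.1 0).val, ZMod.val_lt (q.1 0)⟩, q.2) *
              bgmFatMultiplier V M klE0 β (nambuXiCT V μ K) 0 ω' (⟨(q.1 0).val, ZMod.val_lt (q.1 0)⟩, q.2) *
              sliceSymbolFnXi (β * (V : ℝ) ^ 2) 0 (klScale klE0 2) (klScale klE0 1) (matsubaraFreq β M ⟨(q.1 0).val, ZMod.val_lt (q.1 0)⟩)
                (nambuXiCT V μ K q.2))))‖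
      = ∑ ω' : Fin (sectorCount 0), ∑ z : TorusSite 1 (2 * M) × TorusSite 2 V, w z *
        ‖∑ q : TorusSite 1 (2 * M) × TorusSite 2 V, (torusChar q.1 z.1 * torusChar q.2 z.2) •
          ((((1 / (β * (V : ℝ) ^ 2) : ℝ) : ℂ) ^ 2 *
            sliceSymbolFnXi (β * (V : ℝ) ^ 2) 0 (klScale klE0 2) (klScale klE0 1) (matsubaraFreq β M ⟨(q.1 0).val, ZMod.val_lt (q.1 0)⟩)
              (nambuXiCT V μ K q.2)))‖ := by
        refine Finset.sum_congr rfl fun ω' _ => Finset.sum_congr rfl fun z _ => ?_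
        congr 2
        refine Finset.sum_congr rfl fun q _ => ?_
        rw [bgmFatMultiplier_zero_mul_sliceSymbolFnXi he β μ K hΛ2 hΛ21 hΛ1e _ _ X.2.1.1 ω' ⟨(q.1 0).val, ZMod.val_lt (q.1 0)⟩ q.2]
    _ ≤ ∑ _ω' : Fin (sectorCount 0), T := Finset.sum_le_sum fun ω' _ => hT
    _ = 2 * T := by rw [Finset.sum_const, Finset.card_univ, Fintype.card_fin]; simp [sectorCount]

end StepZero

end Summit.HubbardSuperconductivity.HubbardSuperconductivity.Theorems.TorusFourierL2

end
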